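import Summits.QuantumFields.BalabanUV.Beta.EriceRemainderEnclosureHistoryTwoLoop

/-!
# RemainderExplicitHistoryLogMomentWitness — ROAD P3: THE WEIGHTED FAMILY `β_{k+1} = b + g_k·Σ_{i≤k} λ k i·(g_k − g_i)` AND THE
# LOWER RUN GEOMETRY (`g_k − g_i ≥ g_k·min(1, (k − i)b₀g_k²)∕4`, `g_k² ≥ 1∕(1∕g_K² + β′(K − k))`, `Σ_{m<a} 1∕(P + c(m+1)) ≥ log(…)∕c`)
# — the objects of the sharpness half of station S-d4p3-g43-1 (`RemainderExplicitHistoryLogMomentSharp` draws the conclusion)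

Cell `pub-balaban`, β-function sub-cell, BINDER row D4 «RemainderConst leaves for Bałaban's split» (`HOME/BINDER-OWNERS.md`; owner
lineage `b2b-balaban-beta-an4`; this file by co-owner #3 lineage `b2b-balaban-beta-d4-p3`, road P3 «the reduction road», generation 43,
station S-d4p3-g43-1, fourth file; imports (E30) FILE 1 only), β-FLOW TEAM duty (1); FREEZE (0) honoured (def-free module in road P3's
own `RemainderExplicit*` series; no leaf, no interface, no Literature file).  SOURCE OF THE SHAPES ONLY: [Balaban1987RG1] (0.20) p. 256,
(0.31) and Thm 2 p. 259, (2.12)–(2.14) p. 268, §5 p. 298.  Pure real analysis about ONE explicit toy family (ours, not Bałaban's).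

HONEST FRAMING (page 1 of everything the β sub-cell writes).  *"Discharging BetaPertH makes Bałaban's UV stability UNCONDITIONAL —
a real constructive-QFT result; it is NOT the continuum limit and NOT the Clay problem."*  THIS FILE DISCHARGES NOTHING OF THE
KIND.  It is elementary bookkeeping about the WEIGHTED FAMILY `β_{k+1}(g_0,…,g_k) = b + g_k·Σ_{i≤k} λ k i·(g_k − g_i)` (`b > 0`,
`λ ≥ 0`, `Σ_i λ k i ≤ W`, box smallness `2Wγ² ≤ b`; PROFILE case `λ k i = ρ(k − i)` with `Σ_a ρ(a) ≤ W`), carried as a HYPOTHESIS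
`hβ` on an abstract `β : FlowStep.HBeta` (def-free): a printed split with one-loop part `b`, a two-loop FREE diagonal, (AF-1), the companion `RemainderExplicitHistoryLogMoment`'s
order-(AF-1) modulus (M11) with the profile `λ k i = ρ(k − i)`, two-sided box bounds, continuity, runs (the [I]-side shooting theorem);
and the LOWER run geometry along runs with `b₀ ≤ β ≤ β′` (the companions' upper bounds reversed).  Nothing of Bałaban's (1.22) is
asserted or constructed; row D4 class UNCHANGED (critical-path width 0; instance 0∕1; D4 DISCHARGE NO DATE); NOT B12 Thm 2, NOT
BetaPertH, NOT continuum, NOT Clay.  HONEST DEPENDENCY: continuum YM on T⁴ ⇐ BetaPertH ∧ nine spine estimates (0/9 proved);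
BetaPertH ⇐ (D1) ∧ (D4) ∧ CAP+tail; G-an2-4 gates asym, D1 and NE2/3/4.  ABSOLUTE RULE: nothing is cited as a fact.

WHAT IS PROVED ([folklore]; 0 sorry; 0 `def`).
* §1 THE FAMILY: `sum_profile_le` (`Σ_{i≤k} ρ(k − i) ≤ W`), `hist_abs_le` (the history term is `≤ Wγ` on the box), `exists_split` ∕
  `β1_eq` (printed split with one-loop part `b`), `diagTL_zero` (the diagonal obeys (TL) with `β¹¹_∞ = C₃ = c₁ = 0`), `af1`
  (`|β¹| ≤ Wγ·p_k`), `lower` ∕ `upper` (`b∕2 ≤ β ≤ 3b∕2`), **`orderOneMemory`** ((M11) with the family's own weights — the companion's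
  hypothesis shape, verbatim), `continuousOn`, `runs_exist` (`FlowStep.couplingTrajectory_exists_history` BY NAME) — all for GENERAL
  weights `λ k i ≥ 0` with `Σ_i λ k i ≤ W` (hypothesis `hβ : β k p = b + p_k·Σ_i λ k i·(p_k − p_i)`); the PROFILE case `λ k i = ρ(k − i)`
  used by `RemainderExplicitHistoryLogMomentSharp` enters through `sum_profile_le`.
* §2 LOWER RUN GEOMETRY: `inv_sq_ge_of_lower` (`1∕g_i² ≥ 1∕g_k² + b₀(k − i)` from `β ≥ b₀` along the run), **`run_sub_ge`**
  (`g_k − g_i ≥ g_k·min(1, (k − i)·b₀·g_k²)∕4`: the past coupling of age `a` is AT LEAST that far below — `g_i²(1 + u) ≤ g_k²`,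
  `g_k − g_i = (g_k² − g_i²)∕(g_k + g_i) ≥ g_k·u∕(2(1 + u))`), `run_sq_ge` (`g_k² ≥ 1∕(1∕g_K² + β′(K − k))` from `β ≤ β′`).
* §3 THE LOWER HARMONIC SUM: `sum_inv_add_mul_ge_log` (`(log(P + c(a+1)) − log(P + c))∕c ≤ Σ_{m<a} 1∕(P + c(m+1))`, telescoping
  Mathlib's `Real.log_le_sub_one_of_pos`).
All letters NOT-IN-PRINT; no junction of `BetaFlowAsPrinted` changes.
-/

noncomputable section

open Finset Filter Topology

namespace Summit.QuantumFields.BalabanUV.Beta.RemainderExplicitHistoryLogMomentWitness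

open Literature.MathematicalPhysics.QuantumFieldTheory.Balaban1983to89
open Literature.MathematicalPhysics.QuantumFieldTheory.Balaban1983to89.FlowStep
open Literature.MathematicalPhysics.QuantumFieldTheory.Balaban1983to89.T4CouplingMatching
open Summit.QuantumFields.BalabanUV.Beta.EriceRemainderEnclosureHistoryJunction (abs_sub_le_of_mem_Ioc)
open Summit.QuantumFields.BalabanUV.Beta.EriceRemainderEnclosureHistoryTwoLoop

variable {β : HBeta} {b γ W : ℝ} {ρ : ℕ → ℝ} {lam : ℕ → ℕ → ℝ}

/-! ## §1 The family `β_{k+1}(p) = b + p_k·Σ_{i≤k} λ k i·(p_k − p_i)`, weights `λ k i ≥ 0`, `Σ_i λ k i ≤ W` (a hypothesis on an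
abstract `β`; the PROFILE case is `λ k i = ρ(k − i)`) -/

/-- The profile's weights over one scale sum to at most the total weight: `Σ_{i : Fin (k+1)} ρ(k − i) = Σ_{a<k+1} ρ(a) ≤ W`. [folklore] -/
theorem sum_profile_le (hW : ∀ n, ∑ a ∈ range n, ρ a ≤ W) (k : ℕ) : ∑ i : Fin (k + 1), ρ (k - (i : ℕ)) ≤ W := by
  rw [Fin.sum_univ_eq_sum_range (fun i : ℕ => ρ (k - i)) (k + 1)]
  have := sum_range_reflect ρ (k + 1)
  simp only [add_tsub_cancel_right] at this
  rw [this]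
  exact hW (k + 1)

/-- THE HISTORY TERM IS SMALL ON THE BOX: `|Σ_i λ k i·(p_k − p_i)| ≤ W·γ` (`|p_k − p_i| ≤ γ`, `λ ≥ 0`, `Σ_i λ k i ≤ W`). [folklore] -/
theorem hist_abs_le (hlam0 : ∀ (k : ℕ) (i : Fin (k + 1)), 0 ≤ lam k i) (hlamW : ∀ k, ∑ i : Fin (k + 1), lam k i ≤ W) (hγ : 0 < γ)
    (k : ℕ) (p : Fin (k + 1) → ℝ) (hp : p ∈ Box γ k) : |∑ i : Fin (k + 1), lam k i * (p (Fin.last k) - p i)| ≤ W * γ := by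
  calc |∑ i : Fin (k + 1), lam k i * (p (Fin.last k) - p i)|
      ≤ ∑ i : Fin (k + 1), |lam k i * (p (Fin.last k) - p i)| := abs_sum_le_sum_abs _ _
    _ ≤ ∑ i : Fin (k + 1), lam k i * γ := sum_le_sum fun i _ => by
        rw [abs_mul, abs_of_nonneg (hlam0 _ _)]
        exact mul_le_mul_of_nonneg_left (abs_sub_le_of_mem_Ioc (mem_box.1 hp _) (mem_box.1 hp i)) (hlam0 _ _)
    _ = (∑ i : Fin (k + 1), lam k i) * γ := by rw [sum_mul]
    _ ≤ W * γ := mul_le_mul_of_nonneg_right (hlamW k) hγ.le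

/-- A PRINTED split of the family with one-loop part `b` exists (the history term carries the factor `p_k`, so it vanishes at
`p_k = 0`). [cite: Balaban1987RG1, (2.12)–(2.14) p.268] -/
theorem exists_split
    (hβ : ∀ (k : ℕ) (p : Fin (k + 1) → ℝ), β k p = b + p (Fin.last k) * ∑ i : Fin (k + 1), lam k i * (p (Fin.last k) - p i)) :
    ∃ S : B12Beta.OneLoopSplit β, ∀ k, S.β0 k = b :=
  ⟨⟨fun _ => b, fun k p => p (Fin.last k) * ∑ i : Fin (k + 1), lam k i * (p (Fin.last k) - p i), fun k p => hβ k p,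
    fun k p hp => by simp [hp]⟩, fun _ => rfl⟩

/-- Every split with one-loop part `b` has remainder `β¹ = p_k·Σ_i λ k i·(p_k − p_i)`. [folklore] -/
theorem β1_eq
    (hβ : ∀ (k : ℕ) (p : Fin (k + 1) → ℝ), β k p = b + p (Fin.last k) * ∑ i : Fin (k + 1), lam k i * (p (Fin.last k) - p i))
    (S : B12Beta.OneLoopSplit β) (hS : ∀ k, S.β0 k = b) (k : ℕ) (p : Fin (k + 1) → ℝ) :
    S.β1 k p = p (Fin.last k) * ∑ i : Fin (k + 1), lam k i * (p (Fin.last k) - p i) := by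
  have h := S.split k p
  rw [hS k, hβ k p] at h
  linarith

/-- THE DIAGONAL IS TWO-LOOP FREE: on constant histories `β¹ = 0` — node U2's (TL) with `β¹¹_∞ = C₃ = c₁ = 0`. [folklore] -/
theorem diagTL_zero
    (hβ : ∀ (k : ℕ) (p : Fin (k + 1) → ℝ), β k p = b + p (Fin.last k) * ∑ i : Fin (k + 1), lam k i * (p (Fin.last k) - p i))
    (S : B12Beta.OneLoopSplit β) (hS : ∀ k, S.β0 k = b) (k : ℕ) (x : ℝ) (_hx : 0 < x) (_hxγ : x ≤ γ) :
    |S.β1 k (fun _ : Fin (k + 1) => x) - 0 * x ^ 2| ≤ 0 * x ^ 3 + 0 * (0 : ℝ) ^ k := by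
  rw [β1_eq hβ S hS]; simp

/-- (AF-1) for the family: `|β¹(p)| ≤ Wγ·p_k` on the boxes. [folklore] -/
theorem af1
    (hβ : ∀ (k : ℕ) (p : Fin (k + 1) → ℝ), β k p = b + p (Fin.last k) * ∑ i : Fin (k + 1), lam k i * (p (Fin.last k) - p i))
    (S : B12Beta.OneLoopSplit β) (hS : ∀ k, S.β0 k = b) (hlam0 : ∀ (k : ℕ) (i : Fin (k + 1)), 0 ≤ lam k i) (hlamW : ∀ k, ∑ i : Fin (k + 1), lam k i ≤ W) (hγ : 0 < γ)
    (k : ℕ) (p : Fin (k + 1) → ℝ) (hp : p ∈ Box γ k) : |S.β1 k p| ≤ W * γ * p (Fin.last k) := by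
  rw [β1_eq hβ S hS, abs_mul, abs_of_pos (mem_box.1 hp _).1]
  calc p (Fin.last k) * |∑ i : Fin (k + 1), lam k i * (p (Fin.last k) - p i)| ≤ p (Fin.last k) * (W * γ) :=
        mul_le_mul_of_nonneg_left (hist_abs_le hlam0 hlamW hγ k p hp) (mem_box.1 hp _).1.le
    _ = W * γ * p (Fin.last k) := by ring

/-- LOWER bound on the boxes: `b∕2 ≤ β` when `2Wγ² ≤ b`. [folklore] -/
theorem lower
    (hβ : ∀ (k : ℕ) (p : Fin (k + 1) → ℝ), β k p = b + p (Fin.last k) * ∑ i : Fin (k + 1), lam k i * (p (Fin.last k) - p i))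
    (hlam0 : ∀ (k : ℕ) (i : Fin (k + 1)), 0 ≤ lam k i) (hlamW : ∀ k, ∑ i : Fin (k + 1), lam k i ≤ W) (hγ : 0 < γ) (hsmall : 2 * W * γ ^ 2 ≤ b)
    (k : ℕ) (p : Fin (k + 1) → ℝ) (hp : p ∈ Box γ k) : b / 2 ≤ β k p := by
  rw [hβ k p]
  have hk := mem_box.1 hp (Fin.last k)
  have h := hist_abs_le hlam0 hlamW hγ k p hp
  have h1 : |p (Fin.last k) * ∑ i : Fin (k + 1), lam k i * (p (Fin.last k) - p i)| ≤ W * γ ^ 2 := by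
    rw [abs_mul, abs_of_pos hk.1]
    calc p (Fin.last k) * |∑ i : Fin (k + 1), lam k i * (p (Fin.last k) - p i)| ≤ γ * (W * γ) :=
          mul_le_mul hk.2 h (abs_nonneg _) hγ.le
      _ = W * γ ^ 2 := by ring
  have := neg_abs_le (p (Fin.last k) * ∑ i : Fin (k + 1), lam k i * (p (Fin.last k) - p i))
  linarith

/-- UPPER bound on the boxes: `β ≤ 3b∕2` when `2Wγ² ≤ b`. [folklore] -/
theorem upper
    (hβ : ∀ (k : ℕ) (p : Fin (k + 1) → ℝ), β k p = b + p (Fin.last k) * ∑ i : Fin (k + 1), lam k i * (p (Fin.last k) - p i))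
    (hlam0 : ∀ (k : ℕ) (i : Fin (k + 1)), 0 ≤ lam k i) (hlamW : ∀ k, ∑ i : Fin (k + 1), lam k i ≤ W) (hγ : 0 < γ) (hsmall : 2 * W * γ ^ 2 ≤ b)
    (k : ℕ) (p : Fin (k + 1) → ℝ) (hp : p ∈ Box γ k) : β k p ≤ 3 * b / 2 := by
  rw [hβ k p]
  have hk := mem_box.1 hp (Fin.last k)
  have h := hist_abs_le hlam0 hlamW hγ k p hp
  have h1 : |p (Fin.last k) * ∑ i : Fin (k + 1), lam k i * (p (Fin.last k) - p i)| ≤ W * γ ^ 2 := by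
    rw [abs_mul, abs_of_pos hk.1]
    calc p (Fin.last k) * |∑ i : Fin (k + 1), lam k i * (p (Fin.last k) - p i)| ≤ γ * (W * γ) :=
          mul_le_mul hk.2 h (abs_nonneg _) hγ.le
      _ = W * γ ^ 2 := by ring
  have := le_abs_self (p (Fin.last k) * ∑ i : Fin (k + 1), lam k i * (p (Fin.last k) - p i))
  linarith

/-- **THE FAMILY HAS THE ORDER-(AF-1) MODULUS (M11) WITH ITS OWN WEIGHTS** (the companion `RemainderExplicitHistoryLogMoment`'s
hypothesis shape, verbatim; profile case `λ k i = ρ(k − i)`): for `p_k = q_k`, `|β(p) − β(q)| ≤ p_k·Σ_i λ k i·|p_i − q_i|`. [folklore] -/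
theorem orderOneMemory
    (hβ : ∀ (k : ℕ) (p : Fin (k + 1) → ℝ), β k p = b + p (Fin.last k) * ∑ i : Fin (k + 1), lam k i * (p (Fin.last k) - p i))
    (hlam0 : ∀ (k : ℕ) (i : Fin (k + 1)), 0 ≤ lam k i) (k : ℕ) (p q : Fin (k + 1) → ℝ) (hp : p ∈ Box γ k) (_hq : q ∈ Box γ k)
    (hlast : p (Fin.last k) = q (Fin.last k)) :
    |β k p - β k q| ≤ p (Fin.last k) * ∑ i : Fin (k + 1), lam k i * |p i - q i| := by
  have hk := (mem_box.1 hp (Fin.last k)).1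
  have e : β k p - β k q = p (Fin.last k) * ∑ i : Fin (k + 1), lam k i * (q i - p i) := by
    rw [hβ k p, hβ k q, ← hlast]
    rw [show b + p (Fin.last k) * ∑ i : Fin (k + 1), lam k i * (p (Fin.last k) - p i) -
        (b + p (Fin.last k) * ∑ i : Fin (k + 1), lam k i * (p (Fin.last k) - q i)) =
        p (Fin.last k) * (∑ i : Fin (k + 1), lam k i * (p (Fin.last k) - p i) -
          ∑ i : Fin (k + 1), lam k i * (p (Fin.last k) - q i)) by ring, ← sum_sub_distrib]
    congr 1
    exact sum_congr rfl fun i _ => by ring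
  rw [e, abs_mul, abs_of_pos hk]
  refine mul_le_mul_of_nonneg_left ((abs_sum_le_sum_abs _ _).trans (sum_le_sum fun i _ => ?_)) hk.le
  rw [abs_mul, abs_of_nonneg (hlam0 _ _), abs_sub_comm]

/-- Each `β k` is continuous (a polynomial in the coordinates), in particular on the box. [folklore] -/
theorem continuousOn
    (hβ : ∀ (k : ℕ) (p : Fin (k + 1) → ℝ), β k p = b + p (Fin.last k) * ∑ i : Fin (k + 1), lam k i * (p (Fin.last k) - p i))
    (k : ℕ) : ContinuousOn (β k) (Box γ k) := by
  have e : β k = fun p => b + p (Fin.last k) * ∑ i : Fin (k + 1), lam k i * (p (Fin.last k) - p i) := funext (hβ k)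
  rw [e]
  fun_prop

/-- **THE RUNS EXIST** (`FlowStep.couplingTrajectory_exists_history` from continuity and `b∕2 ≤ β ≤ 3b∕2` on the boxes): for every
`K` and every renormalized `g ∈ ]0,γ]` a solution of (0.20) in the box ending at `gs K = g`. [cite: Balaban1987RG1, Thm 2 p.259] -/
theorem runs_exist
    (hβ : ∀ (k : ℕ) (p : Fin (k + 1) → ℝ), β k p = b + p (Fin.last k) * ∑ i : Fin (k + 1), lam k i * (p (Fin.last k) - p i))
    (hb : 0 < b) (hlam0 : ∀ (k : ℕ) (i : Fin (k + 1)), 0 ≤ lam k i) (hlamW : ∀ k, ∑ i : Fin (k + 1), lam k i ≤ W) (hγ : 0 < γ)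
    (hsmall : 2 * W * γ ^ 2 ≤ b) (K : ℕ) {g : ℝ} (hg : 0 < g) (hgγ : g ≤ γ) :
    ∃ gs : ℕ → ℝ, gs K = g ∧ RGEqH K β gs ∧ ∀ k, k ≤ K → 0 < gs k ∧ gs k ≤ γ := by
  obtain ⟨gs, hK, hrg, hbox, -⟩ := couplingTrajectory_exists_history β hγ (half_pos hb) (by linarith : b / 2 ≤ 3 * b / 2)
    (continuousOn hβ) (lower hβ hlam0 hlamW hγ hsmall) (upper hβ hlam0 hlamW hγ hsmall) K g hg hgγ
  exact ⟨gs, hK, hrg, hbox⟩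

/-! ## §2 Lower run geometry: the past coupling of age `a` is at least `g_k·min(1, a·b₀·g_k²)∕4` below the present one -/

/-- TELESCOPED LOWER BOUND: `β ≥ b₀` at every step of the run ⟹ `1∕g_k² + b₀(k − i) ≤ 1∕g_i²` for `i ≤ k ≤ K`.
[cite: Balaban1987RG1, (0.31) p.259] -/
theorem inv_sq_ge_of_lower {K : ℕ} {gs : ℕ → ℝ} {b₀ : ℝ} (h : RGEqH K β gs)
    (hlo : ∀ j, j < K → b₀ ≤ β j (prefixOf gs j)) {i k : ℕ} (hik : i ≤ k) (hkK : k ≤ K) :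
    1 / (gs k) ^ 2 + b₀ * ((k : ℝ) - i) ≤ 1 / (gs i) ^ 2 := by
  rw [inv_sq_telescopeH h hik hkK]
  have hsum := Finset.card_nsmul_le_sum (Ico i k) (fun m => β m (prefixOf gs m)) b₀
    (fun m hm => hlo m ((Finset.mem_Ico.mp hm).2.trans_le hkK))
  rw [nsmul_eq_mul, Nat.card_Ico, Nat.cast_sub hik] at hsum
  linarith

/-- **THE PAST IS AT LEAST THAT FAR BELOW THE PRESENT.**  Along a run with `β ≥ b₀ > 0` at every step, for `i ≤ k ≤ K`:
`gs k − gs i ≥ gs k·min(1, (k − i)·b₀·(gs k)²)∕4` — from `g_i² ≤ g_k²∕(1 + u)`, `u = (k − i)b₀g_k²`, and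
`g_k − g_i = (g_k² − g_i²)∕(g_k + g_i) ≥ g_k·u∕(2(1 + u)) ≥ g_k·min(1,u)∕4`. [folklore] -/
theorem run_sub_ge {K : ℕ} {gs : ℕ → ℝ} {b₀ : ℝ} (h : RGEqH K β gs) (hpos : ∀ k, k ≤ K → 0 < gs k) (hb₀ : 0 < b₀)
    (hlo : ∀ j, j < K → b₀ ≤ β j (prefixOf gs j)) {i k : ℕ} (hik : i ≤ k) (hkK : k ≤ K) :
    gs k * min 1 (((k : ℝ) - i) * b₀ * (gs k) ^ 2) / 4 ≤ gs k - gs i := by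
  have hgk := hpos k hkK
  have hgi := hpos i (hik.trans hkK)
  have hsign : ∀ j, j < K → 0 ≤ β j (prefixOf gs j) := fun j hj => hb₀.le.trans (hlo j hj)
  have hle : gs i ≤ gs k := run_mono h hpos hsign hik hkK
  set u : ℝ := ((k : ℝ) - i) * b₀ * (gs k) ^ 2 with hu
  have hki : (0 : ℝ) ≤ (k : ℝ) - i := sub_nonneg.2 (by exact_mod_cast hik)
  have hu0 : 0 ≤ u := by positivity
  -- g_i² (1 + u) ≤ g_k²
  have hinv := inv_sq_ge_of_lower h hlo hik hkK
  have hsq : (gs i) ^ 2 * (1 + u) ≤ (gs k) ^ 2 := by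
    have h1 : 1 / (gs k) ^ 2 * ((gs i) ^ 2 * (gs k) ^ 2) = (gs i) ^ 2 := by field_simp
    have h2 : 1 / (gs i) ^ 2 * ((gs i) ^ 2 * (gs k) ^ 2) = (gs k) ^ 2 := by field_simp
    have h3 := mul_le_mul_of_nonneg_right hinv (by positivity : (0 : ℝ) ≤ (gs i) ^ 2 * (gs k) ^ 2)
    rw [add_mul, h1, h2] at h3
    rw [hu]
    linarith [h3]
  -- g_k − g_i ≥ (g_k² − g_i²)/(2 g_k) ≥ g_k² u /((1+u) 2 g_k) = g_k u / (2(1+u))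
  have hdiff : (gs k) ^ 2 * (u / (1 + u)) ≤ (gs k) ^ 2 - (gs i) ^ 2 := by
    rw [mul_div_assoc', le_sub_iff_add_le, div_add' _ _ _ (by positivity), div_le_iff₀ (by positivity)]
    nlinarith
  have hmain : gs k * (u / (1 + u)) / 2 ≤ gs k - gs i := by
    have e : (gs k) ^ 2 - (gs i) ^ 2 = (gs k - gs i) * (gs k + gs i) := by ring
    rw [e] at hdiff
    have h2 : (gs k - gs i) * (gs k + gs i) ≤ (gs k - gs i) * (2 * gs k) :=
      mul_le_mul_of_nonneg_left (by linarith) (by linarith)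
    have h3 : (gs k) ^ 2 * (u / (1 + u)) ≤ (gs k - gs i) * (2 * gs k) := hdiff.trans h2
    rw [div_le_iff₀ (by norm_num : (0 : ℝ) < 2)]
    nlinarith
  -- min(1,u)/4 ≤ (u/(1+u))/2
  have hmin : min 1 u / 4 ≤ u / (1 + u) / 2 := by
    have h1u : 0 < 1 + u := by positivity
    rcases le_total 1 u with h1 | h1
    · rw [min_eq_left h1]
      have : 1 / 2 ≤ u / (1 + u) := by rw [le_div_iff₀ h1u]; linarith
      linarith
    · rw [min_eq_right h1]
      have : u / 2 ≤ u / (1 + u) := by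
        rw [div_le_div_iff₀ (by norm_num : (0 : ℝ) < 2) h1u]; nlinarith
      linarith
  calc gs k * min 1 u / 4 = gs k * (min 1 u / 4) := by ring
    _ ≤ gs k * (u / (1 + u) / 2) := mul_le_mul_of_nonneg_left hmin hgk.le
    _ = gs k * (u / (1 + u)) / 2 := by ring
    _ ≤ gs k - gs i := hmain

/-- LOWER PROFILE: `β ≤ β′` at every step ⟹ `g_k² ≥ 1∕(1∕g_K² + β′(K − k))` for `k ≤ K` (telescoped (0.20)).
[cite: Balaban1987RG1, (0.31) p.259] -/
theorem run_sq_ge {K : ℕ} {gs : ℕ → ℝ} {β' : ℝ} (h : RGEqH K β gs) (hpos : ∀ k, k ≤ K → 0 < gs k) (hβ' : 0 ≤ β')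
    (hup : ∀ j, j < K → β j (prefixOf gs j) ≤ β') {k : ℕ} (hkK : k ≤ K) :
    1 / (1 / (gs K) ^ 2 + β' * ((K : ℝ) - k)) ≤ (gs k) ^ 2 := by
  have htel := inv_sq_telescopeH h hkK le_rfl
  have hsum : ∑ j ∈ Ico k K, β j (prefixOf gs j) ≤ β' * ((K : ℝ) - k) := by
    have := Finset.sum_le_card_nsmul (Ico k K) (fun m => β m (prefixOf gs m)) β' (fun m hm => hup m (Finset.mem_Ico.mp hm).2)
    rw [nsmul_eq_mul, Nat.card_Ico, Nat.cast_sub hkK] at this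
    linarith
  have hgk := hpos k hkK
  have hgK := hpos K le_rfl
  have hKk : (0 : ℝ) ≤ (K : ℝ) - k := sub_nonneg.2 (by exact_mod_cast hkK)
  have hD : 0 < 1 / (gs K) ^ 2 + β' * ((K : ℝ) - k) := by positivity
  rw [div_le_iff₀ hD]
  have : 1 / (gs k) ^ 2 ≤ 1 / (gs K) ^ 2 + β' * ((K : ℝ) - k) := by rw [htel]; linarith
  rw [div_le_iff₀ (pow_pos hgk 2)] at this
  linarith

/-! ## §3 The lower harmonic sum -/

/-- `Σ_{m<a} 1∕(P + c(m+1)) ≥ (log(P + c(a+1)) − log(P + c))∕c` for `P, c > 0` — telescoping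
`log(P + c(m+2)) − log(P + c(m+1)) ≤ c∕(P + c(m+1))` (`log(1 + y) ≤ y`). [folklore] -/
theorem sum_inv_add_mul_ge_log {P c : ℝ} (hP : 0 < P) (hc : 0 < c) (a : ℕ) :
    (Real.log (P + c * ((a : ℝ) + 1)) - Real.log (P + c)) / c ≤ ∑ m ∈ range a, 1 / (P + c * ((m : ℝ) + 1)) := by
  have hstep : ∀ m ∈ range a, (Real.log (P + c * (((m + 1 : ℕ) : ℝ) + 1)) - Real.log (P + c * ((m : ℝ) + 1))) / c ≤
      1 / (P + c * ((m : ℝ) + 1)) := by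
    intro m _
    have hm : (0 : ℝ) ≤ m := Nat.cast_nonneg m
    have hD : 0 < P + c * ((m : ℝ) + 1) := by positivity
    push_cast
    have e : P + c * ((m : ℝ) + 1 + 1) = (P + c * ((m : ℝ) + 1)) * (1 + c / (P + c * ((m : ℝ) + 1))) := by
      field_simp; ring
    rw [e, Real.log_mul hD.ne' (by positivity), add_sub_cancel_left, div_le_iff₀ hc]
    have hl := Real.log_le_sub_one_of_pos (show 0 < 1 + c / (P + c * ((m : ℝ) + 1)) by positivity)
    have e2 : 1 / (P + c * ((m : ℝ) + 1)) * c = c / (P + c * ((m : ℝ) + 1)) := by ring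
    rw [e2]; linarith
  refine le_trans ?_ (sum_le_sum hstep)
  rw [← sum_div, sum_range_sub (fun m : ℕ => Real.log (P + c * ((m : ℝ) + 1))) a]
  simp

end Summit.QuantumFields.BalabanUV.Beta.RemainderExplicitHistoryLogMomentWitness
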